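import Literature.Probability.Percolation.AdjMove
import HarnessLib

/-!
# Supports of the events of the adjacent outer landing (Nolin's Lemma 13, the three disjoint sets)

Topic `Literature/Probability/Percolation`; family `crit-perc` / near-critical percolation on `𝕋`.
A brick of the near-critical arm-separation theorem for four arms in the ADJACENT colour
arrangement (P. Nolin, EJP 13 (2008), Thm. 11, `j = 4`, `σ = BBWW` [arXiv 0711.4948: Thm. 10],
landing step, §4.3 Lemma 13, §4.4): the locality half of the generalised FKG step.

* `ASlot.zoneFin`, `suppA b` (the support of the exits event of the colour `b`: `Λ_{2M}` and the
  exterior footprints of its two exits, in actual coordinates), `suppC b` (the support of its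
  corridors event: spokes through `ρ^{i a}`, arcs/approach/target strips through `ρ^{r + ts a}`);
* `armsE_of_agree`, **`determinedBy_armsE`**; **`determinedBy_corrE`**;
* the disjointness for Lemma 13: `suppA_disjoint_suppC` (the exits of one colour never look at the
  corridors of the other) and `suppC_disjoint_suppC` (the corridors of the two colours are disjoint) —
  from the pair lemmas of `AdjMove.lean`, read back into actual coordinates.

Everything here is proved; no named facts are introduced.

## References

* P. Nolin, Near-critical percolation in two dimensions, *Electron. J. Probab.* 13 (2008), §4.3
  Lemma 13, §4.4 (arXiv 0711.4948: Lemma 12; proof of Thm. 10, p. 12) [Nolin2008].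
-/

noncomputable section

open Set

namespace Literature.Probability.Percolation

open LatticeModels Tube Lanes AdjTipData

namespace ASlot

variable {P : OParams} {σ : ASlot}

/-! ### The reading exponents in actual coordinates -/

/-- **The shift that reads actual sides**: `δA = 6 - r % 6`, so that `sft δA (i' a) = i a` and
`sft δA (ts a) = (r + ts a) % 6`, the reading rotation of the exit `a`. [folklore] -/
def δA (σ : ASlot) : ℕ := 6 - σ.r % 6

/-- the reading rotation of the exit `a` [folklore] -/
def mA (σ : ASlot) (a : Fin 4) : ℕ := (σ.r + ts a) % 6

/-- Reading the actual sides and rotations through `δA`. [folklore] -/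
theorem sft_δA (hR : σ.RouteOK P) (a : Fin 4) : sft σ.δA (σ.i' a) = σ.i a ∧ sft σ.δA (ts a) = σ.mA a ∧ σ.mA a < 6 := by
  have hi := hR.hi a; have ht := ts_lt a
  have hr6 : σ.r % 6 < 6 := Nat.mod_lt _ (by norm_num)
  unfold sft δA ASlot.i' mA
  refine ⟨by omega, by omega, Nat.mod_lt _ (by norm_num)⟩

/-- The reading rotations of the two exits of one colour. [folklore] -/
theorem mA_ex (b : Bool) : σ.mA (ex b 0) = σ.rot b ∧ σ.mA (ex b 1) = (σ.rot b + 1) % 6 := by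
  obtain ⟨t0, t1, t2, t3⟩ := ts_val
  cases b
  · have e0 : ex false 0 = 2 := rfl
    have e1 : ex false 1 = 3 := rfl
    constructor
    · show (σ.r + ts (ex false 0)) % 6 = (σ.r + 3) % 6; rw [e0, t2]
    · show (σ.r + ts (ex false 1)) % 6 = ((σ.r + 3) % 6 + 1) % 6; rw [e1, t3]; omega
  · have e0 : ex true 0 = 0 := rfl
    have e1 : ex true 1 = 1 := rfl
    constructor
    · show (σ.r + ts (ex true 0)) % 6 = σ.r % 6; rw [e0, t0, Nat.add_zero]
    · show (σ.r + ts (ex true 1)) % 6 = (σ.r % 6 + 1) % 6; rw [e1, t1]; omega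

/-! ### The supports -/

variable (P σ)

/-- the exterior footprint box of the exit `a`, as a finite set [folklore] -/
def zoneFin (a : Fin 4) : Finset (Site 2) :=
  triStripFinset (2 * (P.M : ℤ) + 1) (σ.T P a + 1) (2 * σ.k P a) (P.w + 3 * σ.k P a - 2)

/-- the far pieces of the corridor of the exit `a` (reading coordinates), as a finite set [folklore] -/
def farFin (a : Fin 4) : Finset (Site 2) :=
  sitesAll (arc (thinRing (σ.rE P a) P.eA P.sA) (σ.ast a) (σ.aln a)) ∪
    triStripFinset ((σ.rE P a : ℤ) - 2 * P.eA) (σ.tr P a) (σ.W P a) (4 * P.M / 64) ∪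
    triStripFinset ((4 * P.M : ℕ) + 1) (σ.tr P a - (4 * P.M / 64 : ℕ)) (4 * P.M / 16 - 1) (2 * (4 * P.M / 64))

/-- the pieces of the corridor of the exit `a` in actual coordinates [folklore] -/
def pieceFin (a : Fin 4) : Finset (Site 2) :=
  (extSpokeTube P.M (σ.k P a) (σ.T P a) P.w (σ.L P a) P.ε).sites.image (triRotIsoPow (σ.i a)) ∪ (σ.farFin P a).image (triRotIsoPow (σ.mA a))

/-- **The support of the exits event of the colour `b`.** [cite: Nolin2008, §4.3 Lemma 13 (arXiv 0711.4948: Lemma 12, the set `𝒜`)] -/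
def suppA (b : Bool) : Finset (Site 2) :=
  triBall (2 * P.M) ∪ (σ.zoneFin P (ex b 0)).image (triRotIsoPow (σ.i (ex b 0))) ∪ (σ.zoneFin P (ex b 1)).image (triRotIsoPow (σ.i (ex b 1)))

/-- **The support of the corridors event of the colour `b`.** [cite: Nolin2008, §4.3 Lemma 13 (arXiv 0711.4948: Lemma 12, the sets `𝒜^±`)] -/
def suppC (b : Bool) : Finset (Site 2) := σ.pieceFin P (ex b 0) ∪ σ.pieceFin P (ex b 1)

variable {P σ}

/-- The footprint finite set is the footprint box (`2 ≤ w + 3k`). [folklore] -/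
theorem coe_zoneFin (hV : P.ValidA) (hR : σ.RouteOK P) (a : Fin 4) : (↑(σ.zoneFin P a) : Set (Site 2)) = σ.zone P a := by
  obtain ⟨hk1, -, -, -, -, -, -, -, hk₀, -⟩ := efacts hV hR a
  have h2 : 2 ≤ P.w + 3 * σ.k P a := by omega
  ext u
  rw [zoneFin, coe_triStripFinset, mem_triStrip]
  show _ ↔ u ∈ zoneBox P.M (σ.k P a) (σ.T P a) P.w
  unfold zoneBox
  simp only [Set.mem_setOf_eq]
  push_cast [Nat.cast_sub h2]
  constructor <;> rintro ⟨h1, h2, h3, h4⟩ <;> exact ⟨by omega, by omega, by omega, by omega⟩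

/-- The far finite set is the union of the far pieces. [folklore] -/
theorem coe_farFin (a : Fin 4) : (↑(σ.farFin P a) : Set (Site 2)) = σ.arcs P a ∪ σ.apr P a ∪ σ.tgtS P a := by
  rw [farFin, Finset.coe_union, Finset.coe_union, coe_sitesAll, coe_triStripFinset, coe_triStripFinset]; rfl

/-- The corridor pieces in actual coordinates. [folklore] -/
theorem coe_pieceFin (a : Fin 4) : (↑(σ.pieceFin P a) : Set (Site 2)) =
    triRotIsoPow (σ.i a) '' σ.spk P a ∪ triRotIsoPow (σ.mA a) '' (σ.arcs P a ∪ σ.apr P a ∪ σ.tgtS P a) := by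
  rw [pieceFin, Finset.coe_union, Finset.coe_image, Finset.coe_image, coe_sites, coe_farFin]; rfl

/-! ### The exits event is determined by its support -/

/-- Colour reading agrees where the configurations agree. [folklore] -/
theorem colCfg_agree {b : Bool} {ω ω' : SiteConfig (Site 2)} {x : Site 2} (h : x ∈ ω ↔ x ∈ ω') :
    x ∈ colCfg b ω ↔ x ∈ colCfg b ω' := by rw [mem_colCfg, mem_colCfg, h]

/-- **The exits event only looks at its support.** [folklore] -/
theorem armsE_of_agree (hV : P.ValidA) (hR : σ.RouteOK P) (b : Bool) {ω ω' : SiteConfig (Site 2)}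
    (hag : ∀ x ∈ (↑(σ.suppA P b) : Set (Site 2)), x ∈ ω ↔ x ∈ ω') (hω : ω ∈ σ.armsE P b) : ω' ∈ σ.armsE P b := by
  obtain ⟨F₀, F₁, S₀, S₁, hj₀, hj₁, hw₀, hw₁, hm₀, hm₁, hP₀, hP₁, hS₀, hS₁, ht₀, ht₁, hdj⟩ := hω
  have hk₀ : F₀.k = σ.k P (ex b 0) := by show trapScale P.k₀ F₀.j = _; rw [hj₀]; rfl
  have hk₁ : F₁.k = σ.k P (ex b 1) := by show trapScale P.k₀ F₁.j = _; rw [hj₁]; rfl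
  have hz₀ : F₀.z 0 = 2 * (P.M : ℤ) := (mem_trapO.1 F₀.z_mem).2
  have hz₁ : F₁.z 0 = 2 * (P.M : ℤ) := (mem_trapO.1 F₁.z_mem).2
  -- the near sets lie in the support
  have hn : ∀ q : Fin 2, ∀ {F : TrapExit P.M P.n P.k₀ P.K (rotConfig (σ.i (ex b q)) (colCfg b ω))} {S : Set (Site 2)},
      F.k = σ.k P (ex b q) → F.z 0 = 2 * (P.M : ℤ) → (σ.T P (ex b q) ≤ F.z 1 ∧ F.z 1 < σ.T P (ex b q) + P.w) →
      (∀ u ∈ S, 2 * (P.M : ℤ) < triNorm u → ExitTight F.z F.k u) →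
      S ⊆ (triAnnSet P.n (2 * P.M) ∪ trapExitZone P.M F.z F.k) →
      ∀ u ∈ S ∪ triStrip (F.z 0 + F.k) (F.z 1 + F.k) F.k F.k, triRotIsoPow (σ.i (ex b q)) u ∈ (↑(σ.suppA P b) : Set (Site 2)) := by
    intro q F S hk hz hw ht _ u hu
    have hsub := near_subset hV hR (ex b q) (σ.i (ex b q)) hk hz hw ht ⟨u, hu, rfl⟩
    rw [suppA, Finset.coe_union, Finset.coe_union, Finset.coe_image, Finset.coe_image, coe_zoneFin hV hR, coe_zoneFin hV hR]
    rcases hsub with h | h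
    · left; left
      rw [Finset.mem_coe, mem_triBall_iff]; rw [Set.mem_setOf_eq] at h; exact_mod_cast h
    · fin_cases q
      · left; right; exact h
      · right; exact h
  have hag₀ : ∀ u ∈ S₀ ∪ triStrip (F₀.z 0 + F₀.k) (F₀.z 1 + F₀.k) F₀.k F₀.k,
      u ∈ rotConfig (σ.i (ex b 0)) (colCfg b ω) ↔ u ∈ rotConfig (σ.i (ex b 0)) (colCfg b ω') := fun u hu => by
    rw [mem_rotConfig, mem_rotConfig]; exact colCfg_agree (hag _ (hn 0 hk₀ hz₀ hw₀ ht₀ (fun v hv => (hS₀ hv).1) u hu))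
  have hag₁ : ∀ u ∈ S₁ ∪ triStrip (F₁.z 0 + F₁.k) (F₁.z 1 + F₁.k) F₁.k F₁.k,
      u ∈ rotConfig (σ.i (ex b 1)) (colCfg b ω) ↔ u ∈ rotConfig (σ.i (ex b 1)) (colCfg b ω') := fun u hu => by
    rw [mem_rotConfig, mem_rotConfig]; exact colCfg_agree (hag _ (hn 1 hk₁ hz₁ hw₁ ht₁ (fun v hv => (hS₁ hv).1) u hu))
  have hS₀' : S₀ ⊆ (triAnnSet P.n (2 * P.M) ∪ trapExitZone P.M F₀.z F₀.k) ∩ rotConfig (σ.i (ex b 0)) (colCfg b ω') :=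
    fun v hv => ⟨(hS₀ hv).1, (hag₀ v (Or.inl hv)).1 (hS₀ hv).2⟩
  have hS₁' : S₁ ⊆ (triAnnSet P.n (2 * P.M) ∪ trapExitZone P.M F₁.z F₁.k) ∩ rotConfig (σ.i (ex b 1)) (colCfg b ω') :=
    fun v hv => ⟨(hS₁ hv).1, (hag₁ v (Or.inl hv)).1 (hS₁ hv).2⟩
  have hbox₀ : triStrip (F₀.z 0 + F₀.k) (F₀.z 1 + F₀.k) F₀.k F₀.k ∩ rotConfig (σ.i (ex b 0)) (colCfg b ω) ⊆
      rotConfig (σ.i (ex b 0)) (colCfg b ω') := fun v hv => (hag₀ v (Or.inr hv.1)).1 hv.2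
  have hbox₁ : triStrip (F₁.z 0 + F₁.k) (F₁.z 1 + F₁.k) F₁.k F₁.k ∩ rotConfig (σ.i (ex b 1)) (colCfg b ω) ⊆
      rotConfig (σ.i (ex b 1)) (colCfg b ω') := fun v hv => (hag₁ v (Or.inr hv.1)).1 hv.2
  exact ⟨F₀.restrictTo _ hP₀ hS₀' hbox₀, F₁.restrictTo _ hP₁ hS₁' hbox₁, S₀, S₁, hj₀, hj₁, hw₀, hw₁, hm₀, hm₁, hP₀, hP₁, hS₀', hS₁',
    ht₀, ht₁, hdj⟩

/-- **The exits event of the colour `b` is determined by its support.** [cite: Nolin2008, §4.3 Lemma 13 (arXiv 0711.4948: Lemma 12)] -/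
theorem determinedBy_armsE (hV : P.ValidA) (hR : σ.RouteOK P) (b : Bool) : DeterminedBy (σ.armsE P b) ↑(σ.suppA P b) := by
  rw [determinedBy_iff]
  intro ω ω' hωω'
  have hag : ∀ x ∈ (↑(σ.suppA P b) : Set (Site 2)), x ∈ ω ↔ x ∈ ω' := fun x hx => by
    have := Set.ext_iff.1 hωω' x
    simp only [Set.mem_inter_iff] at this
    constructor
    · intro h; exact (this.1 ⟨h, hx⟩).1
    · intro h; exact (this.2 ⟨h, hx⟩).1
  exact ⟨armsE_of_agree hV hR b hag, armsE_of_agree hV hR b fun x hx => (hag x hx).symm⟩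

/-! ### The corridors event is determined by its support -/

/-- One corridor is determined by its pieces (reading coordinates). [folklore] -/
theorem determinedBy_corr1 (i M k : ℕ) (T₀ : ℤ) (w L ε r e s a len : ℕ) (t : ℤ) (W N' : ℕ) :
    DeterminedBy (corr1 i M k T₀ w L ε r e s a len t W N')
      (triRotIsoPow i '' (extSpokeTube M k T₀ w L ε).box ∪ (boxAll (arc (thinRing r e s) a len) ∪
        triStrip ((r : ℤ) - 2 * e) t W (N' / 64) ∪ triStrip ((N' : ℤ) + 1) (t - (N' / 64 : ℕ)) (N' / 16 - 1) (2 * (N' / 64)))) := by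
  unfold corr1 otgtV
  refine (((determinedBy_extSpokeEvent i M k T₀ w L ε).mono subset_union_left).inter ?_).inter ?_ |>.inter ?_
  · refine (determinedBy_eventAll _).mono ?_
    rw [coe_sitesAll]; exact fun v hv => Or.inr (Or.inl (Or.inl hv))
  · refine (determinedBy_triHCross _ _ _ _).mono ?_
    rw [coe_triStripFinset]; exact fun v hv => Or.inr (Or.inl (Or.inr hv))
  · refine (determinedBy_triVCross _ _ _ _).mono ?_
    rw [coe_triStripFinset]; exact fun v hv => Or.inr (Or.inr hv)

/-- A colour-flipped event is determined by the same sites. [folklore] -/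
theorem determinedBy_preimage_compl' {E : Set (SiteConfig (Site 2))} {F : Set (Site 2)} (h : DeterminedBy E F) :
    DeterminedBy (Compl.compl ⁻¹' E) F := by
  rw [determinedBy_iff] at h ⊢
  intro ω ω' hω
  rw [Set.mem_preimage, Set.mem_preimage]
  refine h ωᶜ ω'ᶜ ?_
  ext v
  have := Set.ext_iff.1 hω v
  simp only [Set.mem_inter_iff, Set.mem_compl_iff] at this ⊢
  tauto

/-- Pulling back along colour reading keeps the support. [folklore] -/
theorem determinedBy_preimage_colCfg (b : Bool) {E : Set (SiteConfig (Site 2))} {F : Set (Site 2)} (hE : DeterminedBy E F) :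
    DeterminedBy ((colCfg b) ⁻¹' E) F := by
  cases b
  · have : (colCfg false) ⁻¹' E = Compl.compl ⁻¹' E := by ext ω; simp [colCfg_false]
    rw [this]; exact determinedBy_preimage_compl' hE
  · have : (colCfg true) ⁻¹' E = E := by ext ω; simp [colCfg_true]
    rw [this]; exact hE

/-- **The corridors event of the colour `b` is determined by its support.** [cite: Nolin2008, §4.3 Lemma 13 (arXiv 0711.4948: Lemma 12)] -/
theorem determinedBy_corrE (hR : σ.RouteOK P) (b : Bool) : DeterminedBy (σ.corrE P b) ↑(σ.suppC P b) := by
  obtain ⟨-, -, -, -, -, haR, hi0, hi1, -, hc0, hc1, hrot, -⟩ := iR_facts hR b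
  obtain ⟨m0, m1⟩ := mA_ex (σ := σ) b
  -- the corridors event as a preimage
  have hE : σ.corrE P b = (colCfg b) ⁻¹' (rotConfig (σ.rot b) ⁻¹'
      (corr1 (σ.iR b 0) P.M (σ.k P (ex b 0)) (σ.T P (ex b 0)) P.w (σ.L P (ex b 0)) P.ε (σ.rE P (ex b 0)) P.eA P.sA
          (σ.ast (ex b 0)) (σ.aln (ex b 0)) (σ.tr P (ex b 0)) (σ.W P (ex b 0)) P.N' ∩
        rotConfig 1 ⁻¹' corr1 ((σ.iR b 1 + 5) % 6) P.M (σ.k P (ex b 1)) (σ.T P (ex b 1)) P.w (σ.L P (ex b 1)) P.ε (σ.rE P (ex b 1)) P.eA P.sA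
          (σ.ast (ex b 1)) (σ.aln (ex b 1)) (σ.tr P (ex b 1)) (σ.W P (ex b 1)) P.N')) := by
    ext ω; rfl
  rw [hE]
  have d0 := determinedBy_corr1 (σ.iR b 0) P.M (σ.k P (ex b 0)) (σ.T P (ex b 0)) P.w (σ.L P (ex b 0)) P.ε (σ.rE P (ex b 0)) P.eA P.sA
    (σ.ast (ex b 0)) (σ.aln (ex b 0)) (σ.tr P (ex b 0)) (σ.W P (ex b 0)) P.N'
  have d1 := determinedBy_corr1 ((σ.iR b 1 + 5) % 6) P.M (σ.k P (ex b 1)) (σ.T P (ex b 1)) P.w (σ.L P (ex b 1)) P.ε (σ.rE P (ex b 1)) P.eA P.sA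
    (σ.ast (ex b 1)) (σ.aln (ex b 1)) (σ.tr P (ex b 1)) (σ.W P (ex b 1)) P.N'
  refine (determinedBy_preimage_colCfg b (determinedBy_preimage_rotConfig _
    ((d0.mono subset_union_left).inter ((determinedBy_preimage_rotConfig 1 d1).mono subset_union_right)))).mono ?_
  -- the support, read back in actual coordinates
  rw [suppC, Finset.coe_union, coe_pieceFin, coe_pieceFin, m0, m1]
  rintro v ⟨u, hu, rfl⟩
  rcases hu with (⟨x, hx, rfl⟩ | hu) | ⟨u', hu', rfl⟩
  · -- the spoke of the first exit
    left; left
    refine ⟨x, hx, ?_⟩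
    rw [← hc0, triRotIsoPow_mod_six_apply, triRotIsoPow_add_apply]
  · left; right
    exact ⟨u, hu, rfl⟩
  · rcases hu' with ⟨x, hx, rfl⟩ | hu'
    · right; left
      refine ⟨x, hx, ?_⟩
      rw [← hc1, triRotIsoPow_mod_six_apply, triRotIsoPow_add_apply, triRotIsoPow_add_apply]
    · right; right
      refine ⟨u', hu', ?_⟩
      rw [triRotIsoPow_mod_six_apply, Nat.add_comm, triRotIsoPow_add_apply]

/-! ### The three sets of Lemma 13 are disjoint -/

/-- Exponent identities for reading the pair lemmas in actual coordinates. [folklore] -/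
theorem rot_ids (hR : σ.RouteOK P) (a a' : Fin 4) :
    (sft (ts a') (σ.i' a) + σ.mA a') % 6 = σ.i a ∧ (sft (ts a) (ts a') + σ.mA a) % 6 = σ.mA a' ∧
      (σ.mA a' + 6 - σ.mA a + σ.mA a) % 6 = σ.mA a' := by
  have hi := hR.hi a; have ht := ts_lt a; have ht' := ts_lt a'
  have hr6 : σ.r % 6 < 6 := Nat.mod_lt _ (by norm_num)
  unfold sft ASlot.i' mA
  refine ⟨by omega, by omega, by omega⟩

/-- **The corridor pieces of distinct exits are disjoint** (actual coordinates). [cite: Nolin2008, §4.3 Lemma 13 (arXiv 0711.4948: Lemma 12, `𝒜⁺ ∩ 𝒜⁻ = ∅`)] -/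
theorem pieceFin_disjoint_pieceFin (hV : P.ValidA) (hR : σ.RouteOK P) {a a' : Fin 4} (hne : a ≠ a') :
    Disjoint (↑(σ.pieceFin P a) : Set (Site 2)) ↑(σ.pieceFin P a') := by
  obtain ⟨sa, ta, ma⟩ := sft_δA hR a
  obtain ⟨sa', ta', ma'⟩ := sft_δA hR a'
  obtain ⟨r1, r2, r3⟩ := rot_ids hR a a'
  obtain ⟨r1', r2', -⟩ := rot_ids hR a' a
  rw [coe_pieceFin, coe_pieceFin]
  -- spokes
  have KK : Disjoint (triRotIsoPow (σ.i a) '' σ.spk P a) (triRotIsoPow (σ.i a') '' σ.spk P a') := by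
    have h := spk_disjoint_spk hV hR hne σ.δA; rwa [sa, sa'] at h
  -- a spoke against the far pieces of the other exit
  have KF : ∀ {c c' : Fin 4}, c ≠ c' → sft σ.δA (σ.i' c) = σ.i c → sft σ.δA (ts c') = σ.mA c' →
      (sft (ts c') (σ.i' c) + σ.mA c') % 6 = σ.i c →
      Disjoint (triRotIsoPow (σ.i c) '' σ.spk P c) (triRotIsoPow (σ.mA c') '' (σ.arcs P c' ∪ σ.apr P c' ∪ σ.tgtS P c')) := by
    intro c c' hcc sc tc' rc
    rw [Set.image_union, Set.image_union]
    refine Set.disjoint_union_right.2 ⟨Set.disjoint_union_right.2 ⟨?_, ?_⟩, spk_disjoint_tgtS hV hR c c' _ _⟩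
    · have h := arcs_disjoint_spk hV hR (Ne.symm hcc)
      rw [← image_rot_zero (σ.arcs P c')] at h
      have h' := disjoint_rot_shift (σ.mA c') h
      exact (disjoint_rot_congr (i := 0 + σ.mA c') (j := sft (ts c') (σ.i' c) + σ.mA c') (i' := σ.mA c') (j' := σ.i c)
        (by rw [Nat.zero_add]) (by rw [rc, Nat.mod_eq_of_lt (hR.hi c)]) h').symm
    · have h := spk_disjoint_apr hV hR c c' σ.δA; rwa [sc, tc'] at h
  -- far pieces against far pieces
  have FF : Disjoint (triRotIsoPow (σ.mA a) '' (σ.arcs P a ∪ σ.apr P a ∪ σ.tgtS P a))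
      (triRotIsoPow (σ.mA a') '' (σ.arcs P a' ∪ σ.apr P a' ∪ σ.tgtS P a')) := by
    have AF : ∀ {c c' : Fin 4}, c ≠ c' → (sft (ts c) (ts c') + σ.mA c) % 6 = σ.mA c' → (σ.mA c' + 6 - σ.mA c + σ.mA c) % 6 = σ.mA c' →
        σ.mA c < 6 → σ.mA c' < 6 →
        Disjoint (triRotIsoPow (σ.mA c) '' σ.arcs P c) (triRotIsoPow (σ.mA c') '' (σ.arcs P c' ∪ σ.apr P c' ∪ σ.tgtS P c')) := by
      intro c c' hcc rc mc hc6 hc6'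
      rw [Set.image_union, Set.image_union]
      refine Set.disjoint_union_right.2 ⟨Set.disjoint_union_right.2 ⟨?_, ?_⟩, ?_⟩
      · have h := arcs_disjoint_arcs hV hR hcc (σ.mA c' + 6 - σ.mA c)
        rw [← image_rot_zero (σ.arcs P c)] at h
        have h' := disjoint_rot_shift (σ.mA c) h
        exact disjoint_rot_congr (i' := σ.mA c) (j' := σ.mA c') (by rw [Nat.zero_add]) (by rw [mc, Nat.mod_eq_of_lt hc6']) h'
      · have h := arcs_disjoint_apr hV hR hcc
        rw [← image_rot_zero (σ.arcs P c)] at h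
        have h' := disjoint_rot_shift (σ.mA c) h
        exact disjoint_rot_congr (i' := σ.mA c) (j' := σ.mA c') (by rw [Nat.zero_add]) (by rw [rc, Nat.mod_eq_of_lt hc6']) h'
      · have h := arcs_disjoint_tgtS hV hR c c' (σ.mA c' + 6 - σ.mA c)
        rw [← image_rot_zero (σ.arcs P c)] at h
        have h' := disjoint_rot_shift (σ.mA c) h
        exact disjoint_rot_congr (i' := σ.mA c) (j' := σ.mA c') (by rw [Nat.zero_add]) (by rw [mc, Nat.mod_eq_of_lt hc6']) h'
    obtain ⟨-, -, r3'⟩ := rot_ids hR a' a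
    have SS : Disjoint (triRotIsoPow (σ.mA a) '' (σ.apr P a ∪ σ.tgtS P a)) (triRotIsoPow (σ.mA a') '' (σ.apr P a' ∪ σ.tgtS P a')) := by
      have h := strips_disjoint hV hR hne σ.δA; rwa [ta, ta'] at h
    have e1 : σ.arcs P a ∪ σ.apr P a ∪ σ.tgtS P a = σ.arcs P a ∪ (σ.apr P a ∪ σ.tgtS P a) := Set.union_assoc _ _ _
    have e2 : σ.arcs P a' ∪ σ.apr P a' ∪ σ.tgtS P a' = σ.arcs P a' ∪ (σ.apr P a' ∪ σ.tgtS P a') := Set.union_assoc _ _ _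
    rw [e1, Set.image_union (triRotIsoPow (σ.mA a)) (σ.arcs P a) (σ.apr P a ∪ σ.tgtS P a), Set.disjoint_union_left]
    refine ⟨AF hne r2 r3 ma ma', ?_⟩
    rw [e2, Set.image_union (triRotIsoPow (σ.mA a')) (σ.arcs P a') (σ.apr P a' ∪ σ.tgtS P a'), Set.disjoint_union_right]
    refine ⟨?_, SS⟩
    have h := AF (Ne.symm hne) r2' r3' ma' ma
    rw [e1, Set.image_union (triRotIsoPow (σ.mA a)) (σ.arcs P a) (σ.apr P a ∪ σ.tgtS P a), Set.disjoint_union_right] at h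
    exact h.2.symm
  refine Set.disjoint_union_left.2 ⟨Set.disjoint_union_right.2 ⟨KK, KF hne sa ta' r1⟩, Set.disjoint_union_right.2 ⟨(KF (Ne.symm hne) sa' ta r1').symm, FF⟩⟩

/-- **`Λ_{2M}` and the footprint of an exit miss the corridor pieces of another exit.** [cite: Nolin2008, §4.3 Lemma 13 (arXiv 0711.4948: Lemma 12, `𝒜 ∩ 𝒜^± = ∅`)] -/
theorem zone_disjoint_pieceFin (hV : P.ValidA) (hR : σ.RouteOK P) {a a' : Fin 4} (hne : a ≠ a') :
    Disjoint ({v : Site 2 | triNorm v ≤ 2 * (P.M : ℤ)} ∪ triRotIsoPow (σ.i a) '' σ.zone P a) ↑(σ.pieceFin P a') := by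
  obtain ⟨sa, -, -⟩ := sft_δA hR a
  obtain ⟨sa', -, -⟩ := sft_δA hR a'
  rw [coe_pieceFin]
  refine Set.disjoint_union_left.2 ⟨ball_disjoint_far hV hR a' _ _, Set.disjoint_union_right.2 ⟨?_, zone_disjoint_far hV hR a a' _ _⟩⟩
  have h := zone_disjoint_spk hV hR hne σ.δA; rwa [sa, sa'] at h

/-- The support of the exits event inside the ball and the footprints. [folklore] -/
theorem coe_suppA (hV : P.ValidA) (hR : σ.RouteOK P) (b : Bool) : (↑(σ.suppA P b) : Set (Site 2)) =
    {v : Site 2 | triNorm v ≤ 2 * (P.M : ℤ)} ∪ triRotIsoPow (σ.i (ex b 0)) '' σ.zone P (ex b 0) ∪ triRotIsoPow (σ.i (ex b 1)) '' σ.zone P (ex b 1) := by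
  rw [suppA, Finset.coe_union, Finset.coe_union, Finset.coe_image, Finset.coe_image, coe_zoneFin hV hR, coe_zoneFin hV hR]
  congr 1; congr 1
  ext v; simp [mem_triBall_iff]

/-- The two exits of one colour are not the exits of the other. [folklore] -/
theorem ex_ne_ex (b : Bool) (q q' : Fin 2) : ex b q ≠ ex (!b) q' := by
  unfold ex; cases b <;> fin_cases q <;> fin_cases q' <;> simp

/-- **The exits event of one colour never looks at the corridors of the other.** [cite: Nolin2008, §4.3 Lemma 13 (arXiv 0711.4948: Lemma 12)] -/
theorem suppA_disjoint_suppC (hV : P.ValidA) (hR : σ.RouteOK P) (b : Bool) :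
    Disjoint (σ.suppA P b) (σ.suppC P (!b)) := by
  rw [← Finset.disjoint_coe, coe_suppA hV hR, suppC, Finset.coe_union]
  have h := fun q q' => zone_disjoint_pieceFin hV hR (ex_ne_ex b q q')
  refine Set.disjoint_union_right.2 ⟨?_, ?_⟩
  · exact Set.disjoint_union_left.2 ⟨h 0 0, (h 1 0).mono_left Set.subset_union_right⟩
  · exact Set.disjoint_union_left.2 ⟨h 0 1, (h 1 1).mono_left Set.subset_union_right⟩

/-- **The corridors of the two colours are disjoint.** [cite: Nolin2008, §4.3 Lemma 13 (arXiv 0711.4948: Lemma 12)] -/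
theorem suppC_disjoint_suppC (hV : P.ValidA) (hR : σ.RouteOK P) : Disjoint (σ.suppC P true) (σ.suppC P false) := by
  rw [← Finset.disjoint_coe, suppC, suppC, Finset.coe_union, Finset.coe_union]
  have h := fun q q' => pieceFin_disjoint_pieceFin hV hR (ex_ne_ex true q q')
  exact Set.disjoint_union_left.2 ⟨Set.disjoint_union_right.2 ⟨h 0 0, h 0 1⟩, Set.disjoint_union_right.2 ⟨h 1 0, h 1 1⟩⟩

end ASlot

end Literature.Probability.Percolation
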